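import Mathlib
import Summits.ValiantsHypothesis.ValiantsHypothesis.Theorems.NewtonUnitEquationsTwoProductsReduction

/-!
# Crux `TwoProducts` (stmt-ValiantsHypothesis-5906): pencils of factors supported on ARITHMETIC PROGRESSIONS of any length

Sequel to `…TwoProductsAPTrinomial.lean` (three-term progressions, `≤ 72 (2m+1)²`).  Here the progressions have arbitrary
length `t`: if every factor `f_j`, `g_j` of the two products is supported on its own arithmetic progression
`{a_j + i·d_j : i < t}` (arbitrary base point, step and complex coefficients; e.g. every base-`b` DIGIT factor
`Σ_{i<b} c_i X^{i d}` of KPTT's Example-3 grids, in any base), then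

  `twoProducts_apSupports`:  `#vert Newt(∏_{j<m} f_j − ∏_{j<m} g_j) ≤ 72 (m t + 1)²`,

polynomial in `m` AND `t` (the crux asks `2^{a m}(t+2)^b` for arbitrary supports).  Proof: such a factor is
`X^{a} · P(X^{d})` for a univariate `P ∈ ℂ[Y]` of degree `< t`, which splits over `ℂ` into linear factors
(`IsAlgClosed.splits`, `Polynomial.Splits.eq_prod_roots`); substituting `Y = X^d` writes the factor as a product of at most `t`
polynomials with `≤ 2` monomials (`exists_prod_of_support_subset_ap`, padded with `1`s to exactly `t`), and the tree's
`TwoProducts.Reduction.twoProducts_sparsity_le_two` bounds two products of `m t` binomials.  Honest scope: a special family of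
the crux at `k = 2` (collinear, equally spaced supports per factor); nothing here bears on the general crux or on `VP ≠ VNP`.
[ours; setting KPTT arXiv:1308.2286 §5, Example 3]
-/

set_option linter.dupNamespace false

namespace Summit.ValiantsHypothesis.ValiantsHypothesis.Theorems.TwoProducts.APSupports

open MvPolynomial
open scoped BigOperators Polynomial

/-- Products over `range K` of the entries of a list read with default `1` beyond its length give the list product.
[folklore] -/
theorem prod_range_getD {M : Type*} [CommMonoid M] (L : List M) (K : ℕ) (hK : L.length ≤ K) :
    ∏ k ∈ Finset.range K, L.getD k 1 = L.prod := by
  induction L generalizing K with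
  | nil => simp
  | cons x L ih =>
    obtain ⟨K', rfl⟩ : ∃ K', K = K' + 1 := ⟨K - 1, by simp at hK; omega⟩
    rw [Finset.prod_range_succ', List.prod_cons]
    simp only [List.getD_cons_succ, List.getD_cons_zero]
    rw [mul_comm, ih K' (by simpa using hK)]

/-- Entries of a list read with default `1` are list members or `1`. [folklore] -/
theorem getD_mem_or_eq {M : Type*} (L : List M) (k : ℕ) (d : M) : L.getD k d ∈ L ∨ L.getD k d = d := by
  rw [List.getD_eq_getElem?_getD]
  by_cases hk : k < L.length
  · left; rw [List.getElem?_eq_getElem hk, Option.getD_some]; exact List.getElem_mem hk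
  · right; rw [List.getElem?_eq_none (not_lt.1 hk), Option.getD_none]

/-- The support of `X^d − C r`-type binomials. [folklore] -/
theorem card_support_monomial_sub_C_le (d : Fin 2 →₀ ℕ) (r : ℂ) :
    (monomial d (1 : ℂ) - C r).support.card ≤ 2 := by
  classical
  calc (monomial d (1 : ℂ) - C r).support.card ≤ ((monomial d (1 : ℂ)).support ∪ (C r : MvPolynomial (Fin 2) ℂ).support).card :=
        Finset.card_le_card (support_sub (σ := Fin 2) _ _)
    _ ≤ (monomial d (1 : ℂ)).support.card + (C r : MvPolynomial (Fin 2) ℂ).support.card := Finset.card_union_le _ _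
    _ ≤ 1 + 1 := by
        refine Nat.add_le_add ((Finset.card_le_card support_monomial_subset).trans (by simp)) ?_
        rw [C_apply]; exact (Finset.card_le_card support_monomial_subset).trans (by simp)

/-- **Binomial factorization of an AP-supported polynomial.**  A bivariate polynomial supported on the arithmetic progression
`{a + i·d : i < t}` (`t ≥ 1`) is a product of `t` polynomials with at most two monomials each. [folklore] -/
theorem exists_prod_of_support_subset_ap (t : ℕ) (ht : 0 < t) (f : MvPolynomial (Fin 2) ℂ) (a d : Fin 2 →₀ ℕ)
    (hf : f.support ⊆ (Finset.range t).image (fun i : ℕ => a + i • d)) :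
    ∃ b : Fin t → MvPolynomial (Fin 2) ℂ, (∀ i, (b i).support.card ≤ 2) ∧ f = ∏ i, b i := by
  classical
  by_cases hd : d = 0
  · -- degenerate progression: `f` is a monomial; pad with `1`s
    subst hd
    have himg : (Finset.range t).image (fun i : ℕ => a + i • (0 : Fin 2 →₀ ℕ)) = {a} := by
      ext x
      simp only [smul_zero, add_zero, Finset.mem_image, Finset.mem_range, exists_and_right, Finset.mem_singleton]
      exact ⟨fun ⟨⟨i, hi⟩, hx⟩ => hx.symm, fun hx => ⟨⟨0, ht⟩, hx.symm⟩⟩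
    rw [himg] at hf
    refine ⟨Function.update (fun _ => 1) ⟨0, ht⟩ f, fun i => ?_, ?_⟩
    · rcases eq_or_ne i ⟨0, ht⟩ with rfl | hne
      · rw [Function.update_self]; exact (Finset.card_le_card hf).trans (by simp)
      · rw [Function.update_of_ne hne, ← C_1, C_apply]
        exact (Finset.card_le_card support_monomial_subset).trans (by simp)
    · rw [Finset.prod_update_of_mem (Finset.mem_univ _), Finset.prod_const_one, mul_one]
  -- genuine progression: distinct points
  have hinj : Set.InjOn (fun i : ℕ => a + i • d) (Finset.range t : Set ℕ) := by
    intro i _ j _ hij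
    have hij' : i • d = j • d := add_left_cancel hij
    obtain ⟨x, hx⟩ : ∃ x, d x ≠ 0 := by
      by_contra h; push Not at h; exact hd (Finsupp.ext h)
    have := congrArg (fun v : Fin 2 →₀ ℕ => v x) hij'
    simp only [Finsupp.smul_apply, smul_eq_mul] at this
    exact Nat.eq_of_mul_eq_mul_right (Nat.pos_of_ne_zero hx) this
  -- the univariate polynomial `P` with `f = X^a · P(X^d)`
  set P : ℂ[X] := ∑ i ∈ Finset.range t, Polynomial.monomial i (coeff (a + i • d) f) with hP
  have hfP : f = monomial a 1 * Polynomial.aeval (monomial d (1 : ℂ)) P := by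
    rw [hP, map_sum, Finset.mul_sum]
    have hterm : ∀ i ∈ Finset.range t, monomial a (1 : ℂ) *
        Polynomial.aeval (monomial d (1 : ℂ)) (Polynomial.monomial i (coeff (a + i • d) f)) =
        monomial (a + i • d) (coeff (a + i • d) f) := by
      intro i _
      rw [Polynomial.aeval_monomial, MvPolynomial.algebraMap_eq, monomial_pow, one_pow, C_mul_monomial, monomial_mul,
        one_mul, mul_one]
    have h2 : ∑ x ∈ (Finset.range t).image (fun i : ℕ => a + i • d), monomial x (coeff x f) =
        ∑ i ∈ Finset.range t, monomial (a + i • d) (coeff (a + i • d) f) := Finset.sum_image hinj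
    rw [Finset.sum_congr rfl hterm, ← h2]
    conv_lhs => rw [f.as_sum]
    exact Finset.sum_subset hf (fun e _ he => by rw [notMem_support_iff.1 he, monomial_zero])
  -- `P` splits over `ℂ`
  have hsplit : P.Splits := IsAlgClosed.splits P
  have hdeg : P.natDegree < t := by
    have h1 : P.natDegree ≤ t - 1 := by
      rw [hP]
      refine Polynomial.natDegree_sum_le_of_forall_le _ _ fun i hi => ?_
      exact (Polynomial.natDegree_monomial_le _).trans (by simp at hi; omega)
    omega
  have hroots : P.roots.card < t := by rw [← hsplit.natDegree_eq_card_roots]; exact hdeg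
  -- the binomial list: `X^d − C r` over the roots
  set L : List (MvPolynomial (Fin 2) ℂ) := (P.roots.map fun r => monomial d (1 : ℂ) - C r).toList with hL
  have hLlen : L.length ≤ t - 1 := by
    rw [hL, Multiset.length_toList, Multiset.card_map]; omega
  have hLmem : ∀ y ∈ L, y.support.card ≤ 2 := by
    intro y hy
    rw [hL, Multiset.mem_toList, Multiset.mem_map] at hy
    obtain ⟨r, -, rfl⟩ := hy
    exact card_support_monomial_sub_C_le d r
  have hfL : f = monomial a P.leadingCoeff * L.prod := by
    rw [hfP]
    conv_lhs => rw [hsplit.eq_prod_roots]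
    rw [map_mul, Polynomial.aeval_C, MvPolynomial.algebraMap_eq, map_multiset_prod, Multiset.map_map, ← mul_assoc]
    have e1 : monomial a (1 : ℂ) * C P.leadingCoeff = monomial a P.leadingCoeff := by
      rw [mul_comm, C_mul_monomial, mul_one]
    rw [e1, hL, Multiset.prod_toList]
    congr 1
    refine congrArg _ (Multiset.map_congr rfl fun r _ => ?_)
    simp [Polynomial.aeval_X, Polynomial.aeval_C, MvPolynomial.algebraMap_eq, map_sub]
  -- pad to exactly `t` factors
  refine ⟨fun i => if (i : ℕ) = 0 then monomial a P.leadingCoeff else L.getD ((i : ℕ) - 1) 1, fun i => ?_, ?_⟩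
  · dsimp only
    by_cases hi : (i : ℕ) = 0
    · rw [if_pos hi]; exact (Finset.card_le_card support_monomial_subset).trans (by simp)
    · rw [if_neg hi]
      rcases getD_mem_or_eq L ((i : ℕ) - 1) 1 with h | h
      · exact hLmem _ h
      · rw [h, ← C_1, C_apply]; exact (Finset.card_le_card support_monomial_subset).trans (by simp)
  · rw [Fin.prod_univ_eq_prod_range (fun k => if k = 0 then monomial a P.leadingCoeff else L.getD (k - 1) 1) t]
    obtain ⟨t', rfl⟩ : ∃ t', t = t' + 1 := ⟨t - 1, by omega⟩
    rw [Finset.prod_range_succ']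
    simp only [Nat.succ_ne_zero, if_false, if_true, Nat.add_sub_cancel]
    rw [prod_range_getD L t' (by omega), mul_comm, hfL]

/-- **Pencils of AP-supported factors have polynomially many Newton vertices** (crux `TwoProducts`, `k = 2`): if every `f_j`
and every `g_j` is supported on an arithmetic progression `{a + i·d : i < t}` (own base point and step each), then
`#vert Newt(∏ f − ∏ g) ≤ 72 (m t + 1)²`. [ours; setting KPTT arXiv:1308.2286 §5, Example 3] -/
theorem twoProducts_apSupports (m t : ℕ) (f g : Fin m → MvPolynomial (Fin 2) ℂ)
    (hf : ∀ j, ∃ a d : Fin 2 →₀ ℕ, (f j).support ⊆ (Finset.range t).image (fun i : ℕ => a + i • d))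
    (hg : ∀ j, ∃ a d : Fin 2 →₀ ℕ, (g j).support ⊆ (Finset.range t).image (fun i : ℕ => a + i • d)) :
    (Set.extremePoints ℝ (convexHull ℝ ((fun e : Fin 2 →₀ ℕ => fun i : Fin 2 => ((e i : ℕ) : ℝ)) ''
      ((∏ j, f j - ∏ j, g j).support : Set (Fin 2 →₀ ℕ))))).ncard ≤ 72 * (m * t + 1) ^ 2 := by
  classical
  rcases Nat.eq_zero_or_pos t with ht | ht
  · -- empty progressions: every factor vanishes (or there is no factor); the difference is `0`
    subst ht
    have hF : (∏ j, f j - ∏ j, g j) = 0 := by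
      rcases Nat.eq_zero_or_pos m with hm | hm
      · subst hm; simp
      · obtain ⟨a, d, ha⟩ := hf ⟨0, hm⟩
        obtain ⟨a', d', ha'⟩ := hg ⟨0, hm⟩
        have hf0 : f ⟨0, hm⟩ = 0 := by
          rw [← support_eq_empty, ← Finset.subset_empty]; simpa using ha
        have hg0 : g ⟨0, hm⟩ = 0 := by
          rw [← support_eq_empty, ← Finset.subset_empty]; simpa using ha'
        rw [Finset.prod_eq_zero (Finset.mem_univ _) hf0, Finset.prod_eq_zero (Finset.mem_univ _) hg0, sub_zero]
    rw [hF, support_zero, Finset.coe_empty, Set.image_empty, convexHull_empty]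
    simp
  choose a d had using hf
  choose a' d' had' using hg
  choose b hb hfb using fun j => exists_prod_of_support_subset_ap t ht (f j) (a j) (d j) (had j)
  choose b' hb' hgb using fun j => exists_prod_of_support_subset_ap t ht (g j) (a' j) (d' j) (had' j)
  have hF : (∏ j, f j) = ∏ i : Fin (m * t), b (finProdFinEquiv.symm i).1 (finProdFinEquiv.symm i).2 := by
    rw [Fintype.prod_equiv finProdFinEquiv.symm _ (fun q : Fin m × Fin t => b q.1 q.2) (fun i => rfl),
      Fintype.prod_prod_type]
    exact Finset.prod_congr rfl fun j _ => hfb j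
  have hG : (∏ j, g j) = ∏ i : Fin (m * t), b' (finProdFinEquiv.symm i).1 (finProdFinEquiv.symm i).2 := by
    rw [Fintype.prod_equiv finProdFinEquiv.symm _ (fun q : Fin m × Fin t => b' q.1 q.2) (fun i => rfl),
      Fintype.prod_prod_type]
    exact Finset.prod_congr rfl fun j _ => hgb j
  have h := Summit.ValiantsHypothesis.ValiantsHypothesis.Theorems.TwoProducts.Reduction.twoProducts_sparsity_le_two
    (m * t) 2 (fun i => b (finProdFinEquiv.symm i).1 (finProdFinEquiv.symm i).2)
    (fun i => b' (finProdFinEquiv.symm i).1 (finProdFinEquiv.symm i).2) le_rfl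
    (fun i => hb (finProdFinEquiv.symm i).1 (finProdFinEquiv.symm i).2)
    (fun i => hb' (finProdFinEquiv.symm i).1 (finProdFinEquiv.symm i).2)
  rw [← hF, ← hG] at h
  exact h

end Summit.ValiantsHypothesis.ValiantsHypothesis.Theorems.TwoProducts.APSupports
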